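import Summits.HubbardSuperconductivity.HubbardSuperconductivity.Theses.ThermalWedge
import Summits.HubbardSuperconductivity.HubbardSuperconductivity.Theorems.ThermalWedgeTwSourcedCondensationShallowWindow

/-!
# Route `ThermalWedge`, crux `TwSourcedCondensation` (item `stmt-HubbardSuperconductivity-1697`):
# the entropy staircase with a free DISC CONSTANT `κ`

`--supports stmt-HubbardSuperconductivity-1697` file of the line lead (continuation seat c1, line
`entropy-staircase-linear-regime`); no definition, no `sorry`, no named fact. Notation (docstrings
only): `p̃_L(β,U,μ,h) = log Re Z_β(dWaveSourceTorus L U μ h)/(βL²)` (sourced torus pressure),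
`chord_u(β,h) := p̃_L(β/2,u,h) − p̃_L(β,u,h)` (the dyadic heat chord).

The registered skeleton (`Cruxes/TwSourcedCondensation/Lines/entropy_staircase_linear_regime.lean`)
asks its two interacting stubs (S) `stub_sourceSlack`, (T) `stub_thermalSlack` on the full thermal
window `|h| ≤ 1/β`. A constructive (renormalisation-group) proof naturally delivers them only on a
SMALLER disc `|h| ≤ κ/β` (`βh ≤ κ` is the small parameter of the last-scale source vertex).
`twSourcedCondensation_of_discStubs` re-runs the dyadic entropy staircase with an arbitrary disc
constant `κ ∈ (0,1]` chosen per compact `[μ₁,μ₂]`: rung `β₁ = β/2^k` with `β₁|h| ≤ κ < 2β₁|h|`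
(`tw_aux_minimal_rung`), `h₀ = κ/4`, heat-chord price
`(C₁ + K' + η log β₁)/β₁² ≤ 4(C₁+K')h²/κ² + (4η/κ²)h² log β₁` (so (T_κ) is invoked with
`η = c₀κ²/16`), cutoff `log(1/(|h|+1/β)) ≤ log β₁ + log(2/κ)`; constants `c = c₀/2`,
`C = C₀ + K + 4(C₁+K')/κ² + (c₀/2)log(2/κ)`, `U₀ = min`, `a = min`, `L₀` the finite maximum of
the four thresholds over the ladder `β/2^j`, `j ≤ ⌈β⌉₊` (crux quantifier order respected).
Inputs: the landed free stubs `stub_freeLinearCooperLog` (p77664), `stub_freeLinearThermalLaw`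
(p78799) and the exact ratchet `thermalRatchet_dWaveSource'`. The companion file
`ThermalWedgeTwSourcedCondensationEngineReduction` derives (S_κ), (T_κ) from one two-sided engine
statement shared with the sister crux `TwSourcedInertness`.

Sources: D. Ruelle, *Statistical Mechanics* (1969) §2.5–2.6 (convexity of `β ↦ log Z_β`)
[Ruelle1969]; G. Benfatto, A. Giuliani, V. Mastropietro, Ann. Henri Poincaré 7 (2006) 809, Thm 1.1
and Remark 2 (the expansion whose sourced, general-filling extension the stubs are)
[BenfattoGiulianiMastropietro2006]. Tree: `stub_freeLinearCooperLog`, `stub_freeLinearThermalLaw`,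
`thermalRatchet_dWaveSource'`, `tw_aux_minimal_rung`,
`TwSourcedCondensation.Negative.log_cutoff_le_log`.
-/

noncomputable section

namespace Summit.HubbardSuperconductivity.HubbardSuperconductivity.Theorems

open Matrix Finset Literature.MathematicalPhysics.QuantumLattice
open Summit.HubbardSuperconductivity.HubbardSuperconductivity.Theses.ThermalWedge

/-! ### Elementary helpers -/

/-- Monotonicity of the ceiling: `β ≤ e^{a/U}` and `a ≤ a'`, `U > 0` give `β ≤ e^{a'/U}`.
[folklore] -/
theorem le_exp_div_of_le' {β a a' U : ℝ} (hU : 0 < U) (h : β ≤ Real.exp (a / U)) (haa : a ≤ a') :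
    β ≤ Real.exp (a' / U) :=
  h.trans (Real.exp_le_exp.2 (div_le_div_of_nonneg_right haa hU.le))

/-- The cutoff logarithm is below `log β₁ + log (2/κ)` when `κ < 2|h|β₁`, `κ > 0`. [folklore] -/
theorem log_cutoff_le_log_rung_kappa {β β₁ h κ : ℝ} (hβ : 0 < β) (hβ₁ : 0 < β₁) (hκ : 0 < κ)
    (hh : κ < |h| * (2 * β₁)) :
    Real.log (1 / (|h| + 1 / β)) ≤ Real.log β₁ + Real.log (2 / κ) := by
  have hhpos : 0 < |h| := by
    by_contra h0
    push Not at h0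
    have : |h| * (2 * β₁) ≤ 0 := mul_nonpos_of_nonpos_of_nonneg h0 (by positivity)
    linarith
  have h1 : 0 < |h| + 1 / β := by positivity
  have h2 : 1 / (|h| + 1 / β) ≤ β₁ * (2 / κ) := by
    rw [div_le_iff₀ h1]
    have h3 : 0 ≤ β₁ * (2 / κ) * (1 / β) := by positivity
    have h6 : β₁ * (2 / κ) * |h| = (|h| * (2 * β₁)) / κ := by ring
    have h7 : 1 ≤ (|h| * (2 * β₁)) / κ := by
      rw [le_div_iff₀ hκ]; linarith
    have h8 : β₁ * (2 / κ) * (|h| + 1 / β) = β₁ * (2 / κ) * |h| + β₁ * (2 / κ) * (1 / β) := by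
      ring
    linarith
  calc Real.log (1 / (|h| + 1 / β)) ≤ Real.log (β₁ * (2 / κ)) :=
        Real.log_le_log (by positivity) h2
    _ = Real.log β₁ + Real.log (2 / κ) := Real.log_mul hβ₁.ne' (by positivity)

/-! ### The entropy staircase with a free disc constant `κ` -/

/-- **Entropy staircase with a disc constant.** Suppose that for every compact `[μ₁,μ₂] ⊂ (-4,0)`
there is `κ ∈ (0,1]` such that the two interacting slacks hold in DISC form — (S_κ) `∀ η ∃ U₀ a K`:
`[p̃_0(β,h) − p̃_0(β,0)] − (η log β + K)h² ≤ p̃_U(β,h) − p̃_U(β,0)` and (T_κ) `∀ η ∃ U₀ a K'`: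
`[chord_U − chord_0](β,h) ≤ (η log β + K')/β²`, for `0 < U ≤ U₀`, `1 ≤ β ≤ e^{a/U}`, `μ ∈ [μ₁,μ₂]`,
eventually in `L`, on `|h| ≤ κ/β`. Then `TwSourcedCondensation` holds (`c = c₀/2`, `h₀ = κ/4`,
`C = C₀ + K + 4(C₁+K')/κ² + (c₀/2) log(2/κ)`; the free inputs are the landed
`stub_freeLinearCooperLog`, `stub_freeLinearThermalLaw`). [cite: Ruelle1969, §2.5] -/
theorem twSourcedCondensation_of_discStubs :
    (∀ μ₁ μ₂ : ℝ, -4 < μ₁ → μ₁ ≤ μ₂ → μ₂ < 0 → ∃ κ : ℝ, 0 < κ ∧ κ ≤ 1 ∧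
      (∀ η : ℝ, 0 < η → ∃ U₀ a K : ℝ, 0 < U₀ ∧ 0 < a ∧ 0 < K ∧
        ∀ U : ℝ, 0 < U → U ≤ U₀ → ∀ β : ℝ, 1 ≤ β → β ≤ Real.exp (a / U) →
        ∀ μ ∈ Set.Icc μ₁ μ₂, ∃ L₀ : ℕ, ∀ (L : ℕ) [NeZero L], L₀ ≤ L → ∀ h : ℝ, |h| ≤ κ / β →
          (Real.log (Matrix.partitionFn β
            (Literature.MathematicalPhysics.QuantumLattice.dWaveSourceTorus L 0 μ h)).re /
            (β * (L : ℝ) ^ 2) -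
              Real.log (Matrix.partitionFn β
            (Literature.MathematicalPhysics.QuantumLattice.dWaveSourceTorus L 0 μ 0)).re /
            (β * (L : ℝ) ^ 2)) -
            (η * Real.log β + K) * h ^ 2 ≤
          Real.log (Matrix.partitionFn β
            (Literature.MathematicalPhysics.QuantumLattice.dWaveSourceTorus L U μ h)).re /
            (β * (L : ℝ) ^ 2) -
            Real.log (Matrix.partitionFn β
            (Literature.MathematicalPhysics.QuantumLattice.dWaveSourceTorus L U μ 0)).re /
            (β * (L : ℝ) ^ 2)) ∧
      (∀ η : ℝ, 0 < η → ∃ U₀ a K' : ℝ, 0 < U₀ ∧ 0 < a ∧ 0 < K' ∧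
        ∀ U : ℝ, 0 < U → U ≤ U₀ → ∀ β : ℝ, 1 ≤ β → β ≤ Real.exp (a / U) →
        ∀ μ ∈ Set.Icc μ₁ μ₂, ∃ L₀ : ℕ, ∀ (L : ℕ) [NeZero L], L₀ ≤ L → ∀ h : ℝ, |h| ≤ κ / β →
          (Real.log (Matrix.partitionFn (β / 2)
            (Literature.MathematicalPhysics.QuantumLattice.dWaveSourceTorus L U μ h)).re /
            (β / 2 * (L : ℝ) ^ 2) -
              Real.log (Matrix.partitionFn β
            (Literature.MathematicalPhysics.QuantumLattice.dWaveSourceTorus L U μ h)).re /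
            (β * (L : ℝ) ^ 2)) -
            (Real.log (Matrix.partitionFn (β / 2)
            (Literature.MathematicalPhysics.QuantumLattice.dWaveSourceTorus L 0 μ h)).re /
            (β / 2 * (L : ℝ) ^ 2) -
              Real.log (Matrix.partitionFn β
            (Literature.MathematicalPhysics.QuantumLattice.dWaveSourceTorus L 0 μ h)).re /
            (β * (L : ℝ) ^ 2)) ≤
          (η * Real.log β + K') / β ^ 2)) →
    Summit.HubbardSuperconductivity.HubbardSuperconductivity.Theses.ThermalWedge.TwSourcedCondensation := by
  classical
  intro hST μ₁ μ₂ h4 h12 h0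
  obtain ⟨c₀, C₀, hc₀, hC₀, hF⟩ := stub_freeLinearCooperLog μ₁ μ₂ h4 h12 h0
  obtain ⟨C₁, hC₁, hFh⟩ := stub_freeLinearThermalLaw μ₁ μ₂ h4 h12 h0
  obtain ⟨κ, hκ, hκ1, hS, hT⟩ := hST μ₁ μ₂ h4 h12 h0
  obtain ⟨U₁, a₁, K, hU₁, ha₁, hK, hS⟩ := hS (c₀ / 4) (by positivity)
  obtain ⟨U₂, a₂, K', hU₂, ha₂, hK', hT⟩ := hT (c₀ * κ ^ 2 / 16) (by positivity)
  have hlog2κ : 0 < Real.log (2 / κ) := Real.log_pos (by rw [lt_div_iff₀ hκ]; linarith)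
  have hκsq : 0 < κ ^ 2 := by positivity
  -- the two new constants, kept opaque in the linear arithmetic below
  set M : ℝ := 4 * (C₁ + K') / κ ^ 2 with hMdef
  set ℓ : ℝ := Real.log (2 / κ) with hℓdef
  have hM : 0 < M := by positivity
  have hCpos : 0 < C₀ + K + M + c₀ / 2 * ℓ := by
    have : 0 < c₀ / 2 * ℓ := mul_pos (by positivity) hlog2κ
    linarith
  refine ⟨min U₁ U₂, min a₁ a₂, c₀ / 2, C₀ + K + M + c₀ / 2 * ℓ, κ / 4,
    lt_min hU₁ hU₂, lt_min ha₁ ha₂, by positivity, hCpos, by positivity, ?_⟩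
  intro U hU hUU₀ β hβ hβa μ hμ
  have hβpos : 0 < β := by linarith
  have hUU₁ : U ≤ U₁ := hUU₀.trans (min_le_left _ _)
  have hUU₂ : U ≤ U₂ := hUU₀.trans (min_le_right _ _)
  have hβa₁ : β ≤ Real.exp (a₁ / U) := le_exp_div_of_le' hU hβa (min_le_left _ _)
  have hβa₂ : β ≤ Real.exp (a₂ / U) := le_exp_div_of_le' hU hβa (min_le_right _ _)
  -- total versions of the four `eventually in L` hypotheses (at this `U, μ`), then choice functions
  have hF' : ∀ β' : ℝ, ∃ L₀ : ℕ, 1 ≤ β' → ∀ (L : ℕ) [NeZero L], L₀ ≤ L → ∀ h : ℝ, |h| ≤ 1 / β' →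
      c₀ * h ^ 2 * Real.log β' - C₀ * h ^ 2 ≤
        Real.log (Matrix.partitionFn β'
            (Literature.MathematicalPhysics.QuantumLattice.dWaveSourceTorus L 0 μ h)).re /
            (β' * (L : ℝ) ^ 2) -
          Real.log (Matrix.partitionFn β'
            (Literature.MathematicalPhysics.QuantumLattice.dWaveSourceTorus L 0 μ 0)).re /
            (β' * (L : ℝ) ^ 2) := by
    intro β'
    by_cases hb : 1 ≤ β'
    · obtain ⟨L₀, hL₀⟩ := hF β' hb μ hμ
      exact ⟨L₀, fun _ => hL₀⟩
    · exact ⟨0, fun h1 => (hb h1).elim⟩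
  have hFh' : ∀ β' : ℝ, ∃ L₀ : ℕ, 1 ≤ β' → ∀ (L : ℕ) [NeZero L], L₀ ≤ L → ∀ h : ℝ, |h| ≤ 1 / β' →
      Real.log (Matrix.partitionFn (β' / 2)
            (Literature.MathematicalPhysics.QuantumLattice.dWaveSourceTorus L 0 μ h)).re /
            (β' / 2 * (L : ℝ) ^ 2) -
          Real.log (Matrix.partitionFn β'
            (Literature.MathematicalPhysics.QuantumLattice.dWaveSourceTorus L 0 μ h)).re /
            (β' * (L : ℝ) ^ 2) ≤ C₁ / β' ^ 2 := by
    intro β'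
    by_cases hb : 1 ≤ β'
    · obtain ⟨L₀, hL₀⟩ := hFh β' hb μ hμ
      exact ⟨L₀, fun _ => hL₀⟩
    · exact ⟨0, fun h1 => (hb h1).elim⟩
  have hS' : ∀ β' : ℝ, ∃ L₀ : ℕ, 1 ≤ β' → β' ≤ Real.exp (a₁ / U) → ∀ (L : ℕ) [NeZero L], L₀ ≤ L →
      ∀ h : ℝ, |h| ≤ κ / β' →
      (Real.log (Matrix.partitionFn β'
            (Literature.MathematicalPhysics.QuantumLattice.dWaveSourceTorus L 0 μ h)).re /
            (β' * (L : ℝ) ^ 2) -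
          Real.log (Matrix.partitionFn β'
            (Literature.MathematicalPhysics.QuantumLattice.dWaveSourceTorus L 0 μ 0)).re /
            (β' * (L : ℝ) ^ 2)) -
        (c₀ / 4 * Real.log β' + K) * h ^ 2 ≤
      Real.log (Matrix.partitionFn β'
            (Literature.MathematicalPhysics.QuantumLattice.dWaveSourceTorus L U μ h)).re /
            (β' * (L : ℝ) ^ 2) -
        Real.log (Matrix.partitionFn β'
            (Literature.MathematicalPhysics.QuantumLattice.dWaveSourceTorus L U μ 0)).re /
            (β' * (L : ℝ) ^ 2) := by
    intro β'
    by_cases hb : 1 ≤ β' ∧ β' ≤ Real.exp (a₁ / U)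
    · obtain ⟨L₀, hL₀⟩ := hS U hU hUU₁ β' hb.1 hb.2 μ hμ
      exact ⟨L₀, fun _ _ => hL₀⟩
    · exact ⟨0, fun h1 h2 => (hb ⟨h1, h2⟩).elim⟩
  have hT' : ∀ β' : ℝ, ∃ L₀ : ℕ, 1 ≤ β' → β' ≤ Real.exp (a₂ / U) → ∀ (L : ℕ) [NeZero L], L₀ ≤ L →
      ∀ h : ℝ, |h| ≤ κ / β' →
      (Real.log (Matrix.partitionFn (β' / 2)
            (Literature.MathematicalPhysics.QuantumLattice.dWaveSourceTorus L U μ h)).re /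
            (β' / 2 * (L : ℝ) ^ 2) -
          Real.log (Matrix.partitionFn β'
            (Literature.MathematicalPhysics.QuantumLattice.dWaveSourceTorus L U μ h)).re /
            (β' * (L : ℝ) ^ 2)) -
        (Real.log (Matrix.partitionFn (β' / 2)
            (Literature.MathematicalPhysics.QuantumLattice.dWaveSourceTorus L 0 μ h)).re /
            (β' / 2 * (L : ℝ) ^ 2) -
          Real.log (Matrix.partitionFn β'
            (Literature.MathematicalPhysics.QuantumLattice.dWaveSourceTorus L 0 μ h)).re /
            (β' * (L : ℝ) ^ 2)) ≤
      (c₀ * κ ^ 2 / 16 * Real.log β' + K') / β' ^ 2 := by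
    intro β'
    by_cases hb : 1 ≤ β' ∧ β' ≤ Real.exp (a₂ / U)
    · obtain ⟨L₀, hL₀⟩ := hT U hU hUU₂ β' hb.1 hb.2 μ hμ
      exact ⟨L₀, fun _ _ => hL₀⟩
    · exact ⟨0, fun h1 h2 => (hb ⟨h1, h2⟩).elim⟩
  choose fF hfF using hF'
  choose fFh hfFh using hFh'
  choose fS hfS using hS'
  choose fT hfT using hT'
  -- L₀: the largest threshold over the dyadic ladder β / 2^j, j ≤ ⌈β⌉₊
  refine ⟨(Finset.range (⌈β⌉₊ + 1)).sup fun j =>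
    max (max (fF (β / 2 ^ j)) (fFh (β / 2 ^ j))) (max (fS (β / 2 ^ j)) (fT (β / 2 ^ j))), ?_⟩
  intro L _ hL h hh
  have hLj : ∀ j, j ≤ ⌈β⌉₊ → fF (β / 2 ^ j) ≤ L ∧ fFh (β / 2 ^ j) ≤ L ∧
      fS (β / 2 ^ j) ≤ L ∧ fT (β / 2 ^ j) ≤ L := by
    intro j hj
    have hmem : j ∈ Finset.range (⌈β⌉₊ + 1) := Finset.mem_range.mpr (Nat.lt_succ_of_le hj)
    have hsup := (Finset.le_sup (f := fun j =>
      max (max (fF (β / 2 ^ j)) (fFh (β / 2 ^ j))) (max (fS (β / 2 ^ j)) (fT (β / 2 ^ j))))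
        hmem).trans hL
    exact ⟨((le_max_left _ _).trans (le_max_left _ _)).trans hsup,
      ((le_max_right _ _).trans (le_max_left _ _)).trans hsup,
      ((le_max_left _ _).trans (le_max_right _ _)).trans hsup,
      ((le_max_right _ _).trans (le_max_right _ _)).trans hsup⟩
  have hsq : 0 ≤ h ^ 2 := sq_nonneg h
  -- notation for the pressures
  set P : ℝ → ℝ → ℝ → ℝ := fun b u s =>
    Real.log (partitionFn b (dWaveSourceTorus L u μ s)).re / (b * (L : ℝ) ^ 2) with hPdef
  rcases le_or_gt (|h| * β) κ with hlin | hout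
  · -- Case A: inside the disc at β itself (rung j = 0)
    have hwin : |h| ≤ κ / β := by
      rw [le_div_iff₀ hβpos]
      exact hlin
    have hwin1 : |h| ≤ 1 / β := hwin.trans (div_le_div_of_nonneg_right hκ1 hβpos.le)
    have h0' := hLj 0 (Nat.zero_le _)
    simp only [pow_zero, div_one] at h0'
    have h1 := hfF β hβ L h0'.1 h hwin1
    have h2 := hfS β hβ hβa₁ L h0'.2.2.1 h hwin
    have hlogβ : 0 ≤ Real.log β := Real.log_nonneg hβ
    have hcut : Real.log (1 / (|h| + 1 / β)) ≤ Real.log β :=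
      TwSourcedCondensation.Negative.log_cutoff_le_log hβpos h
    have h3 : c₀ / 2 * h ^ 2 * Real.log (1 / (|h| + 1 / β)) ≤ c₀ / 2 * h ^ 2 * Real.log β :=
      mul_le_mul_of_nonneg_left hcut (by positivity)
    have h4 : 0 ≤ h ^ 2 * Real.log β := by positivity
    change c₀ / 2 * h ^ 2 * Real.log (1 / (|h| + 1 / β)) - (C₀ + K + M + c₀ / 2 * ℓ) * h ^ 2 ≤
      P β U h - P β U 0
    change c₀ * h ^ 2 * Real.log β - C₀ * h ^ 2 ≤ P β 0 h - P β 0 0 at h1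
    change (P β 0 h - P β 0 0) - (c₀ / 4 * Real.log β + K) * h ^ 2 ≤ P β U h - P β U 0 at h2
    have h5 : 0 ≤ (M + c₀ / 2 * ℓ) * h ^ 2 := by
      have h7 : 0 < c₀ / 2 * ℓ := mul_pos (half_pos hc₀) hlog2κ
      exact mul_nonneg (by linarith only [h7, hM]) hsq
    have h6 : 0 ≤ c₀ * (h ^ 2 * Real.log β) := mul_nonneg hc₀.le h4
    linarith only [h1, h2, h3, h5, h6]
  · -- Case B: climb the dyadic ladder to the disc
    have hsmall : |h| < κ / 2 := by linarith
    obtain ⟨k, hkK, hkspec, hone, -, hprev⟩ := tw_aux_minimal_rung hκ hβ hsmall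
    have hkpos : 0 < k := by
      rcases Nat.eq_zero_or_pos k with hk0 | hkp
      · exfalso
        rw [hk0, pow_zero, div_one] at hkspec
        linarith
      · exact hkp
    have hprev' : κ < |h| * (2 * (β / 2 ^ k)) := hprev hkpos
    set β₁ : ℝ := β / 2 ^ k with hβ₁def
    have hβ₁pos : 0 < β₁ := by positivity
    have hβ₁le : β₁ ≤ β := div_le_self hβpos.le (one_le_pow₀ (by norm_num))
    have hwin : |h| ≤ κ / β₁ := by
      rw [le_div_iff₀ hβ₁pos]
      exact hkspec
    have hwin1 : |h| ≤ 1 / β₁ := hwin.trans (div_le_div_of_nonneg_right hκ1 hβ₁pos.le)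
    have hLk := hLj k hkK
    have hlogβ₁ : 0 ≤ Real.log β₁ := Real.log_nonneg hone
    have hcut : Real.log (1 / (|h| + 1 / β)) ≤ Real.log β₁ + ℓ :=
      log_cutoff_le_log_rung_kappa hβpos hβ₁pos hκ hprev'
    -- w := 1/β₁² and κ² w ≤ 4 h²
    set w : ℝ := 1 / β₁ ^ 2 with hwdef
    have hw : 0 ≤ w := by positivity
    have hb2 : 0 < β₁ ^ 2 := by positivity
    have hinv : κ ^ 2 * w ≤ 4 * h ^ 2 := by
      have h7 : 0 ≤ |h| * (2 * β₁) := by positivity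
      have h6 : κ ^ 2 ≤ (|h| * (2 * β₁)) ^ 2 := pow_le_pow_left₀ hκ.le hprev'.le 2
      have e : (|h| * (2 * β₁)) ^ 2 = 4 * h ^ 2 * β₁ ^ 2 := by rw [mul_pow, mul_pow, sq_abs]; ring
      rw [hwdef, show κ ^ 2 * (1 / β₁ ^ 2) = κ ^ 2 / β₁ ^ 2 by ring, div_le_iff₀ hb2]
      linarith only [h6, e]
    -- the two prices in terms of h²
    have hprice1 : (C₁ + K') * w ≤ M * h ^ 2 := by
      have hw4 : w ≤ 4 * h ^ 2 / κ ^ 2 := by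
        rw [le_div_iff₀ hκsq]; linarith only [hinv]
      calc (C₁ + K') * w ≤ (C₁ + K') * (4 * h ^ 2 / κ ^ 2) :=
            mul_le_mul_of_nonneg_left hw4 (by linarith only [hC₁, hK'])
        _ = M * h ^ 2 := by rw [hMdef]; ring
    have hprice2 : c₀ * κ ^ 2 / 16 * Real.log β₁ * w ≤ c₀ / 4 * (h ^ 2 * Real.log β₁) := by
      calc c₀ * κ ^ 2 / 16 * Real.log β₁ * w = c₀ / 16 * Real.log β₁ * (κ ^ 2 * w) := by ring
        _ ≤ c₀ / 16 * Real.log β₁ * (4 * h ^ 2) :=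
            mul_le_mul_of_nonneg_left hinv (mul_nonneg (by positivity) hlogβ₁)
        _ = c₀ / 4 * (h ^ 2 * Real.log β₁) := by ring
    have ew : C₁ / β₁ ^ 2 = C₁ * w := by rw [hwdef]; ring
    have ew' : (c₀ * κ ^ 2 / 16 * Real.log β₁ + K') / β₁ ^ 2 =
        (c₀ * κ ^ 2 / 16 * Real.log β₁ + K') * w := by rw [hwdef]; ring
    -- the pressures enter only now
    have h1 := hfF β₁ hone L hLk.1 h hwin1
    have h2 := hfFh β₁ hone L hLk.2.1 h hwin1
    have h3 := hfS β₁ hone (hβ₁le.trans hβa₁) L hLk.2.2.1 h hwin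
    have h5 := hfT β₁ hone (hβ₁le.trans hβa₂) L hLk.2.2.2 h hwin
    have hrat := thermalRatchet_dWaveSource' L U μ h hβ₁pos hβ₁le
    change c₀ / 2 * h ^ 2 * Real.log (1 / (|h| + 1 / β)) - (C₀ + K + M + c₀ / 2 * ℓ) * h ^ 2 ≤
      P β U h - P β U 0
    change c₀ * h ^ 2 * Real.log β₁ - C₀ * h ^ 2 ≤ P β₁ 0 h - P β₁ 0 0 at h1
    change P (β₁ / 2) 0 h - P β₁ 0 h ≤ C₁ / β₁ ^ 2 at h2
    change (P β₁ 0 h - P β₁ 0 0) - (c₀ / 4 * Real.log β₁ + K) * h ^ 2 ≤ P β₁ U h - P β₁ U 0 at h3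
    change (P (β₁ / 2) U h - P β₁ U h) - (P (β₁ / 2) 0 h - P β₁ 0 h) ≤
      (c₀ * κ ^ 2 / 16 * Real.log β₁ + K') / β₁ ^ 2 at h5
    change (P β₁ U h - P β₁ U 0) - (P (β₁ / 2) U h - P β₁ U h) ≤ P β U h - P β U 0 at hrat
    rw [ew] at h2
    rw [ew'] at h5
    -- the interacting heat chord at β₁ in terms of h²
    have hchord : P (β₁ / 2) U h - P β₁ U h ≤ M * h ^ 2 + c₀ / 4 * (h ^ 2 * Real.log β₁) := by
      linarith only [h2, h5, hprice1, hprice2]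
    have h10 : c₀ / 2 * h ^ 2 * Real.log (1 / (|h| + 1 / β)) ≤
        c₀ / 2 * h ^ 2 * (Real.log β₁ + ℓ) :=
      mul_le_mul_of_nonneg_left hcut (by positivity)
    linarith only [h1, h3, hrat, hchord, h10]

end Summit.HubbardSuperconductivity.HubbardSuperconductivity.Theorems
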